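import Mathlib
import HarnessLib
import HarnessLib.Audit
import Summits.Langlands.Langlands.Theorems.MordellWeilSevenSplit
import Summits.Langlands.Langlands.Theorems.SqrtFiveQuarticCoversReductionToRefinedLocusStubFiveSpanOdd
import Summits.Langlands.Langlands.Theorems.SqrtFiveQuarticCoversGroupCensusFive
import Literature.NumberTheory.Automorphic.TotallyRealModularityBoxImagesProofs
import Literature.NumberTheory.Automorphic.FLSThreeFiveSwitchingProofs

/-!
# CartanFiveSplit — lens-5 g36: the `√5`-SECTOR of RES36 = `MordellWeilSevenSplit.Residual36` HAS A DOOR —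
# the level-`3·5` CARTAN door (FLS 2015 Thm. 3 at `p = 3` AND `p = 5`, the `𝔽₅` group census for `det ⊆ {±1}`),
# valid over EVERY totally real field containing `√5`; RES36 ⟸ FLS3 ∧ FMD ∧ `Residual37`, EXACT

THESIS.  RES36 (tree decl `Summit.Langlands.Langlands.Theorems.MordellWeilSevenSplit.Residual36`, p836178) is RES34 on the
fields of `15`-growth AND `7`-growth; its hard core, flagged IDEA-NEEDED by g35/g36 ("no door"), is the sector `√5 ∈ K₀`
(where clause (ii) of `Box2022_theorem1_3` — Thorne 2016 — is void) and inside it the doubly-entangled fields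
`ℚ(√5, ζ₇+ζ₇⁻¹) ⊆ K₀` (where clause (iii) is void too).  There IS a door on the whole `√5`-sector, and it is typed in the
tree: a non-modular `E / K₀` over ANY totally real `K₀` has a Borel-or-`C_s⁺(3)` framing of `E[3]`
(`Literature.NumberTheory.Automorphic.Box2022.clause_three`, from FLS 2015 Thm. 3 at `p = 3`), and a framing of `E[5]`
with an odd element and non-spanning determinant-one part (the lg-quartmod cell's
`SqrtFiveQuarticCovers.stub_fiveSpanOdd_of_FLS2015_theorem3`, FLS 2015 Thm. 3 at `p = 5` + Prop. 3.1 (i), degree-free);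
when `√5 ∈ K₀` its determinant is `±1`-valued (`GroupCensusFive.stub_detSqrtFive`, landed) and the LANDED finite census
`GroupCensusFive.stub_censusTrichotomy` (= the closed support item `GroupCensusFive`, stmt-Langlands-17592: "three
subgroups of orders `6`, `8`, `12`" [FreitasLeHungSiksek2015, Remark (iii) after Cor. 2.1]) conjugates the image into the
Borel `B(5)`, into `H8 = ⟨diag(2,3), antidiag(1,1)⟩ ⊂ C_s⁺(5)` or into `H12 = ⟨(3 1;3 3), diag(1,4)⟩ ⊂ C_ns⁺(5)`.
DOOR (junction **C5D** `CartanFiveDoor`, PROVED here modulo the single named fact `FLS2015_theorem3`,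
`cartanFiveDoor_of_FLS2015_theorem3`): over a totally real `K₀ ∋ √5` a non-modular `E` has shape
`(b3 ∨ s3⁺) ∧ (b5 ∨ H8 ∨ H12)` — it is a `K₀`-point of one of the six curves `X(u3, v5)`, `u ∈ {b, s}`, `v ∈ {b, H8, H12}`
[Box2022, Thm. 7.1 and §7.1: "we cannot do any better than this at `5` without stronger modularity lifting results for
fields containing `√5`"].  CONSEQUENCE for the residual: the `√5`-sector of RES36 splits by SHAPE into a Borel-`5` cell
and two Cartan cells; the Borel-`5` cell on `15`-STABLE fields is EMPTY of candidates by g35's moduli door FMD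
(`FifteenModuliDoor`: shape `(b3 ∨ s3⁺, b5)` + `15A1(K₀) = 15A1(ℚ)`, `X(s3,b5)(K₀) = X(s3,b5)(ℚ)` ⇒ `j ∈ ℚ`, never in the
residual range) — the FIRST closed piece of the `√5`-sector (`stableBorelFiveCell36_closed`).  So
RES36 ⟸ C5D ∧ FMD ∧ `Residual37`, `Residual37` := (RES36 on `√5 ∉ K₀`) ∧ (Borel-`5` cell on `15`-growth `√5`-fields) ∧
(`H8` cell) ∧ (`H12` cell), EXACT (`residual36_iff_residual37`).  One storey up, the field-level form: over a `15`-stable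
totally real `K₀ ∋ √5`, every NON-modular `E` lives on `X(u3,H8)` or `X(u3,H12)` (`cartan_of_not_modular_of_stable`,
modulo FLS3 ∧ FMD ∧ DBC) — the `√5`-analogue of g35's `modular_of_stable`, with the Cartan curves as the named remainder.

WHY THIS LINE.  g35 (NEXT-g36) and g36 (NEXT-g37 §A) recorded the `√5 ∧ ζ₇⁺` sector as "no door: a door would have to
be a new modularity lifting theorem".  That overlooked FLS 2015 Thm. 3, whose hypothesis is big image on `Γ_{K(ζ_p)}`,
not `√5 ∉ K`: its failure at `p = 5` over `K ∋ √5` leaves exactly the `det ⊆ {±1}` census of FLS Remark (iii), which the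
lg-quartmod cell had already typed, proved (`GroupCensusFive`, closed) and composed for QUARTIC fields with level `7`
(`reductionToRefinedLocus_of_FLS2015_theorem3_of_Box2022_theorem1_3`).  This node transplants the degree-free part of
that composition into the decomp-langlands residual tower, where it is new: every previous dial of the lineage at `5`
went through clause (ii) (`BorelAt K₀ E 5` under `√5 ∉ K₀`).  Nearest tree prior art: `SqrtFiveQuarticCovers.
ReductionToRefinedLocus` (quartic, with `7`; crux 17834 open), `FLSModFiveImageSqrtFive.modFive_image_of_not_
isModularEllipticCurve` (the image properties), g35 `MordellWeilFifteenSplit` / `MordellWeilSevenSplit` (Mordell–Weil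
dials needing `√5 ∉ K₀` resp. `ℚ(ζ₇)⁺ ⊄ K₀`).  DELTA: a shape door on the `√5`-sector in EVERY degree, the sector's first
closed cell, and the residual re-expressed on four named Cartan curves (`H8`/`H12` × `b3`/`s3`).

RANKED CRUXES.  `Residual37` (rank 2; RESIDUAL, WEAKER, EXACT modulo C5D ∧ FMD): its conjuncts `H8Cell36`, `H12Cell36`
are the typed content of Box's "monumental task" in arbitrary degree (K₀-points of `X(b3,H8)`, `X(s3,H8)`, `X(b3,H12)`,
`X(s3,H12)`; per FIXED field finite by Faltings; NOT tower-stable: `X(b3,ns5)/w₃ ≅ ℙ¹` [Box2022 §7.1] feeds `k`-curves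
at every quadratic step — the natural next junction is `k`-curve descent to the index-`2` subfield, an object-class
widening to `GL₂`-type abelian surfaces, IDEA-level); `GrowthBorelFiveCell36` is g35-instrumentable (2-descent on
`15A1` per field); `NonSqrtFiveSector36` is g35's territory verbatim.  `CartanFiveDoor` (rank 3; PRINT junction, PROVED
modulo `FLS2015_theorem3`).  `FifteenModuliDoor` (g35's binder, unchanged).

KILL CRITERIA.  A totally real `K₀ ∋ √5` and a non-modular-candidate `E / K₀` in the residual range whose mod-`5` image
has `det ⊄ {±1}` (impossible: Weil pairing) or is irreducible on `Γ_{K₀(ζ₅)}` yet not covered by FLS Thm. 3 (would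
refute the named fact, not this node).  The node's own theorems are sorry-free.

NOT DECOMPOSED YET.  The four Cartan cells by curve (models of `X(u3,H8)`, `X(u3,H12)` are not in the tree; the
lg-quartmod cell's `CertB3H8 / CertS3H8 / CertS3H12 / CertH12B7` are the quadratic-points-over-`ℚ(√5)` versions WITH
level `7`, disjoint from this sector since quartic fields never contain `ζ₇+ζ₇⁻¹`).

CHEAPEST FALSIFIER.  `15A1(ℚ(√5, ζ₇+ζ₇⁻¹)) = 15A1(ℚ)`? (2-descent over one sextic field; if it holds, the smallest
doubly-entangled field has NO Borel-`5` candidates at all and its residual is the four Cartan curves.)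

HONEST STATUS.  CONDITIONAL node: `cartanFiveDoor_of_FLS2015_theorem3` consumes the named fact `FLS2015_theorem3`
(a printed modularity lifting theorem, `def … : Prop`, not proved in the tree); `FifteenModuliDoor` and
`RatBaseChangeModularity` enter only the corollaries that name them.  Nothing here proves modularity of a single curve;
the closed cell is closed because it is EMPTY (rational `j` is outside the residual range).  Count-neutral NODE.

References: [FreitasLeHungSiksek2015] N. Freitas, B. V. Le Hung, S. Siksek, Invent. Math. 201 (2015) 159–206 =
arXiv:1310.7088 — Thm. 3; Prop. 3.1 (i) and proof of Prop. 9.1 (the odd-element / non-spanning conditions, as cited by the tree's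
`stub_fiveSpanOdd_of_FLS2015_theorem3`); Remark (iii) after Cor. 2.1 (the `det ⊆ {1̄, 4̄}` census of orders `6, 8, 12`: held text p. 20);
[Box2022] J. Box, Trans. AMS 375 (2022) = arXiv:2103.13975 — Thm. 1.3, Thm. 7.1, §7.1 (held text p. 30); [Thorne2016]
J. Thorne, Math. Ann. 364 (2016) (clause (ii), `√5 ∉ K`); [Kalyanswamy2018] Math. Res. Lett. 25 (clause (iii) input).
-/

set_option linter.dupNamespace false -- project-wide option; `Summit.Langlands.Langlands` is the mandated namespace

open scoped NumberField IntermediateField MatrixGroups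
open NumberField Field Literature.NumberTheory.Automorphic
open Literature.NumberTheory.GaloisRepresentations
open Summit.Langlands.Langlands.Theorems.DepthIsolationSplit (UnanchoredBox IntegralModelTransferPointwise)
open Summit.Langlands.Langlands.Theorems.JDegreeFilterSplit (jInv jDeg InResidualRange RatBaseChangeModularity
  SmallFieldBaseChange isModularEllipticCurve_of_jInv_eq_ratCast)
open Summit.Langlands.Langlands.Theorems.DyadicDoorSplit (AllenLocus AllenDyadicCorollary)
open Summit.Langlands.Langlands.Theorems.OddPrimeDoorSplit (OffDoors SkinnerWilesDihedralDoor PanZhangSupersingularDoor)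
open Summit.Langlands.Langlands.Theorems.RealCyclotomicDoorSplit (BorelAt BorelOrSplitCartanThree)
open Summit.Langlands.Langlands.Theorems.ReductionSignatureSplit (OffSignatureDoors NearlyOrdinaryDihedralDoorThree
  SplitOrdinaryDihedralDoor MixedSignatureDoor)
open Summit.Langlands.Langlands.Theorems.NearlyOrdinaryDistinguishedSplit (OnNODDoor NearlyOrdinaryDistinguishedDoor)
open Summit.Langlands.Langlands.Theorems.MordellWeilFifteenSplit (FifteenStable Growth FifteenModuliDoor Residual35
  not_inResidualRange_of_ratCast)
open Summit.Langlands.Langlands.Theorems.MordellWeilSevenSplit (SevenGrowth SevenModuliDoor Residual36 residual35_of_pieces)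
open Summit.Langlands.Langlands.Theorems.SqrtFiveQuarticCovers (stub_fiveSpanOdd_of_FLS2015_theorem3)

namespace Summit.Langlands.Langlands.Theorems.CartanFiveSplit

/-! ## §1 The two Cartan shapes at `5` (generators VERBATIM those of `SqrtFiveQuarticCovers.ReductionToRefinedLocus`) -/

/-- `H8`-SHAPE at `5`: some framing of `E[5]` takes values in `H8 = ⟨diag(2,3), antidiag(1,1)⟩ ≅ D₄ ⊂ C_s⁺(5)` (the order-`8`
subgroup of FLS Remark (iii); the level structure of the curve `X(H8) → X(s5)`). -/
def H8At (K₀ : Type) [Field K₀] [NumberField K₀] (E : WeierstrassCurve (𝓞 K₀)) : Prop :=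
  ∃ ρ : FramedGaloisRep K₀ (ZMod 5) 2, (E.baseChange K₀).IsTorsionGaloisRep 5 ρ ∧
    ∀ σ : absoluteGaloisGroup K₀, (ρ σ : GL (Fin 2) (ZMod 5)) ∈
      Subgroup.closure ({(⟨!![2, 0; 0, 3], !![3, 0; 0, 2], by decide, by decide⟩ : GL (Fin 2) (ZMod 5)),
        (⟨!![0, 1; 1, 0], !![0, 1; 1, 0], by decide, by decide⟩ : GL (Fin 2) (ZMod 5))} : Set (GL (Fin 2) (ZMod 5)))

/-- `H12`-SHAPE at `5`: some framing of `E[5]` takes values in `H12 = ⟨(3 1;3 3), diag(1,4)⟩ ≅ D₆ ⊂ C_ns⁺(5)` (contains the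
order-`6` subgroup; the level structure of the curve `X(H12) → X(ns5)`). -/
def H12At (K₀ : Type) [Field K₀] [NumberField K₀] (E : WeierstrassCurve (𝓞 K₀)) : Prop :=
  ∃ ρ : FramedGaloisRep K₀ (ZMod 5) 2, (E.baseChange K₀).IsTorsionGaloisRep 5 ρ ∧
    ∀ σ : absoluteGaloisGroup K₀, (ρ σ : GL (Fin 2) (ZMod 5)) ∈
      Subgroup.closure ({(⟨!![3, 1; 3, 3], !![3, 4; 2, 3], by decide, by decide⟩ : GL (Fin 2) (ZMod 5)),
        (⟨!![1, 0; 0, 4], !![1, 0; 0, 4], by decide, by decide⟩ : GL (Fin 2) (ZMod 5))} : Set (GL (Fin 2) (ZMod 5)))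

/-- The CARTAN-`5` SHAPE of a non-modular curve over a field containing `√5`: Borel, or `H8`, or `H12`. -/
def CartanFiveShape (K₀ : Type) [Field K₀] [NumberField K₀] (E : WeierstrassCurve (𝓞 K₀)) : Prop :=
  BorelAt K₀ E 5 ∨ H8At K₀ E ∨ H12At K₀ E

/-! ## §2 The door C5D and its proof from FLS 2015 Thm. 3 -/

/-- **C5D — CARTAN FIVE DOOR** (PRINT junction).  Over a totally real `K₀` containing `√5`, an integral `E` (`Δ ≠ 0`) that
is NOT modular (trace-only rendering `IsModularEllipticCurve`) has a Borel-or-`C_s⁺(3)` framing of `E[3]` and a Borel-,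
`H8`- or `H12`-valued framing of `E[5]`.  [Box2022, Thm. 7.1 (proof: "we can use [freitas]")]
[FreitasLeHungSiksek2015, Thm. 3; Remark (iii) after Cor. 2.1] -/
def CartanFiveDoor : Prop :=
  ∀ (K₀ : Type) [Field K₀] [NumberField K₀], IsTotallyReal K₀ → IsSquare (5 : K₀) →
    ∀ E : WeierstrassCurve (𝓞 K₀), E.Δ ≠ 0 → ¬ IsModularEllipticCurve K₀ E →
      BorelOrSplitCartanThree K₀ E ∧ CartanFiveShape K₀ E

/-- **C5D holds modulo the named fact `FLS2015_theorem3`** (KERNEL: composition of `Box2022.clause_three`, the lg-quartmod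
cell's degree-free `stub_fiveSpanOdd_of_FLS2015_theorem3`, and the LANDED `GroupCensusFive.stub_detSqrtFive`,
`GroupCensusFive.stub_censusTrichotomy`, re-framed by `FLS2015.isTorsionGaloisRep_conj`).  CONDITIONAL on FLS Thm. 3 only;
no degree hypothesis, no hypothesis at `7`. [cite: FreitasLeHungSiksek2015, Thm. 3; Remark (iii) after Cor. 2.1]
[cite: Box2022, Thm. 7.1] -/
theorem cartanFiveDoor_of_FLS2015_theorem3 (h3 : FLS2015_theorem3) : CartanFiveDoor := by
  intro K₀ _ _ hK h5 E hΔ hne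
  refine ⟨?_, ?_⟩
  · haveI := hK
    exact Box2022.clause_three h3 K₀ E hΔ (not_isAutomorphicOfWeightZero_of_not_isModularEllipticCurve hΔ hne)
  · obtain ⟨ρ, hfr, ⟨σ₀, htr, hdet₀⟩, hspan⟩ := stub_fiveSpanOdd_of_FLS2015_theorem3 h3 K₀ hK E hΔ hne
    have h5K : ∃ r : K₀, r ^ 2 = 5 := by
      obtain ⟨r, hr⟩ := h5
      exact ⟨r, by rw [sq]; exact hr.symm⟩
    have hdetρ := GroupCensusFive.stub_detSqrtFive K₀ h5K E hΔ ρ hfr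
    obtain ⟨x, hx⟩ := GroupCensusFive.stub_censusTrichotomy ρ.toMonoidHom.range
      (by rintro _ ⟨σ, rfl⟩; exact hdetρ σ) ⟨ρ σ₀, ⟨σ₀, rfl⟩, htr, hdet₀⟩ hspan
    have hfr' : (E.baseChange K₀).IsTorsionGaloisRep 5 (FramedRep.conj x ρ) :=
      FLS2015.isTorsionGaloisRep_conj hfr x
    rcases hx with hB | hH8 | hH12
    · refine Or.inl ⟨FramedRep.conj x ρ, hfr', fun σ => ?_⟩
      rw [FramedRep.conj_apply]
      exact hB (ρ σ) ⟨σ, rfl⟩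
    · refine Or.inr (Or.inl ⟨FramedRep.conj x ρ, hfr', fun σ => ?_⟩)
      rw [FramedRep.conj_apply]
      exact hH8 (ρ σ) ⟨σ, rfl⟩
    · refine Or.inr (Or.inr ⟨FramedRep.conj x ρ, hfr', fun σ => ?_⟩)
      rw [FramedRep.conj_apply]
      exact hH12 (ρ σ) ⟨σ, rfl⟩

/-! ## §3 The pieces of RES36 by `√5` and by shape -/

/-- RES36 OFF the `√5`-sector (`√5 ∉ K₀`: genuine `15`-growth by points; g35's Mordell–Weil instruments apply). -/
def NonSqrtFiveSector36 : Prop :=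
  ∀ (K₀ : Type) [Field K₀] [NumberField K₀], UnanchoredBox K₀ → Growth K₀ → SevenGrowth K₀ → ¬ IsSquare (5 : K₀) →
    ∀ E : WeierstrassCurve (𝓞 K₀), E.Δ ≠ 0 → InResidualRange K₀ E → ¬ AllenLocus K₀ E → OffDoors K₀ E →
      OffSignatureDoors K₀ E → ¬ OnNODDoor K₀ E → IsModularEllipticCurve K₀ E

/-- The BOREL-`5` cell of the `√5`-sector on `15`-STABLE fields (CLOSED — empty — from FMD, `stableBorelFiveCell36_closed`). -/
def StableBorelFiveCell36 : Prop :=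
  ∀ (K₀ : Type) [Field K₀] [NumberField K₀], UnanchoredBox K₀ → Growth K₀ → SevenGrowth K₀ → IsSquare (5 : K₀) →
    FifteenStable K₀ →
    ∀ E : WeierstrassCurve (𝓞 K₀), E.Δ ≠ 0 → InResidualRange K₀ E → ¬ AllenLocus K₀ E → OffDoors K₀ E →
      OffSignatureDoors K₀ E → ¬ OnNODDoor K₀ E → BorelOrSplitCartanThree K₀ E → BorelAt K₀ E 5 →
        IsModularEllipticCurve K₀ E

/-- The BOREL-`5` cell of the `√5`-sector on `15`-GROWTH fields (RESIDUAL; instrumentable per field by `2`-descent on `15A1`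
and the isogenous `X(s3,b5)` model, exactly as g35). -/
def GrowthBorelFiveCell36 : Prop :=
  ∀ (K₀ : Type) [Field K₀] [NumberField K₀], UnanchoredBox K₀ → Growth K₀ → SevenGrowth K₀ → IsSquare (5 : K₀) →
    ¬ FifteenStable K₀ →
    ∀ E : WeierstrassCurve (𝓞 K₀), E.Δ ≠ 0 → InResidualRange K₀ E → ¬ AllenLocus K₀ E → OffDoors K₀ E →
      OffSignatureDoors K₀ E → ¬ OnNODDoor K₀ E → BorelOrSplitCartanThree K₀ E → BorelAt K₀ E 5 →
        IsModularEllipticCurve K₀ E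

/-- The `H8` cell of the `√5`-sector (RESIDUAL: `K₀`-points of `X(b3,H8)`, `X(s3,H8)` in the residual range). -/
def H8Cell36 : Prop :=
  ∀ (K₀ : Type) [Field K₀] [NumberField K₀], UnanchoredBox K₀ → Growth K₀ → SevenGrowth K₀ → IsSquare (5 : K₀) →
    ∀ E : WeierstrassCurve (𝓞 K₀), E.Δ ≠ 0 → InResidualRange K₀ E → ¬ AllenLocus K₀ E → OffDoors K₀ E →
      OffSignatureDoors K₀ E → ¬ OnNODDoor K₀ E → BorelOrSplitCartanThree K₀ E → H8At K₀ E →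
        IsModularEllipticCurve K₀ E

/-- The `H12` cell of the `√5`-sector (RESIDUAL: `K₀`-points of `X(b3,H12)`, `X(s3,H12)` in the residual range). -/
def H12Cell36 : Prop :=
  ∀ (K₀ : Type) [Field K₀] [NumberField K₀], UnanchoredBox K₀ → Growth K₀ → SevenGrowth K₀ → IsSquare (5 : K₀) →
    ∀ E : WeierstrassCurve (𝓞 K₀), E.Δ ≠ 0 → InResidualRange K₀ E → ¬ AllenLocus K₀ E → OffDoors K₀ E →
      OffSignatureDoors K₀ E → ¬ OnNODDoor K₀ E → BorelOrSplitCartanThree K₀ E → H12At K₀ E →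
        IsModularEllipticCurve K₀ E

/-- **Residual37 — THE DECLARED RESIDUAL** (WEAKER than RES36; EXACT modulo C5D ∧ FMD): RES36 off the `√5`-sector, the
Borel-`5` cell on `15`-growth `√5`-fields, and the two Cartan cells. -/
def Residual37 : Prop :=
  NonSqrtFiveSector36 ∧ GrowthBorelFiveCell36 ∧ H8Cell36 ∧ H12Cell36

/-! ## §4 Kernel: the stable Borel-`5` cell is empty; RES36 from the pieces; exactness -/

/-- **The `15`-stable Borel-`5` cell of the `√5`-sector is CLOSED** (it is empty: FMD makes `j` rational, and a rational `j`
is never in the residual range — g35's `not_inResidualRange_of_ratCast`).  No base change, no lifting theorem. -/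
theorem stableBorelFiveCell36_closed (hF : FifteenModuliDoor) : StableBorelFiveCell36 := by
  intro K₀ _ _ _ _ _ _ hst E hΔ hr _ _ _ _ h3 hb
  obtain ⟨q, hq⟩ := hF K₀ E hΔ h3 hb hst
  exact absurd hr (not_inResidualRange_of_ratCast E hq)

/-- `Residual36 → Residual37` (each piece is RES36 with extra hypotheses). -/
theorem residual37_of_residual36 (h : Residual36) : Residual37 :=
  ⟨fun K₀ _ _ hU hG hS _ E hΔ hr hA hO hSig hN => h K₀ hU hG hS E hΔ hr hA hO hSig hN,
    fun K₀ _ _ hU hG hS _ _ E hΔ hr hA hO hSig hN _ _ => h K₀ hU hG hS E hΔ hr hA hO hSig hN,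
    fun K₀ _ _ hU hG hS _ E hΔ hr hA hO hSig hN _ _ => h K₀ hU hG hS E hΔ hr hA hO hSig hN,
    fun K₀ _ _ hU hG hS _ E hΔ hr hA hO hSig hN _ _ => h K₀ hU hG hS E hΔ hr hA hO hSig hN⟩

/-- **RES36 from the pieces**: C5D ∧ FMD ∧ `Residual37` ⇒ `Residual36`.  On the `√5`-sector a non-modular candidate has a
door shape (C5D); the Borel-`5` shape on a `15`-stable field is impossible in the residual range (FMD), every other
shape/field combination is a conjunct of `Residual37`. -/
theorem residual36_of_pieces (hD : CartanFiveDoor) (hF : FifteenModuliDoor) (hR : Residual37) : Residual36 := by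
  intro K₀ _ _ hU hG hS E hΔ hr hA hO hSig hN
  by_cases h5 : IsSquare (5 : K₀)
  · by_contra hne
    obtain ⟨h3, hb | h8 | h12⟩ := hD K₀ hU.1 h5 E hΔ hne
    · by_cases hst : FifteenStable K₀
      · exact hne (stableBorelFiveCell36_closed hF K₀ hU hG hS h5 hst E hΔ hr hA hO hSig hN h3 hb)
      · exact hne (hR.2.1 K₀ hU hG hS h5 hst E hΔ hr hA hO hSig hN h3 hb)
    · exact hne (hR.2.2.1 K₀ hU hG hS h5 E hΔ hr hA hO hSig hN h3 h8)
    · exact hne (hR.2.2.2 K₀ hU hG hS h5 E hΔ hr hA hO hSig hN h3 h12)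
  · exact hR.1 K₀ hU hG hS h5 E hΔ hr hA hO hSig hN

/-- **EXACTNESS**: modulo C5D ∧ FMD, `Residual36 ↔ Residual37`. -/
theorem residual36_iff_residual37 (hD : CartanFiveDoor) (hF : FifteenModuliDoor) : Residual36 ↔ Residual37 :=
  ⟨residual37_of_residual36, residual36_of_pieces hD hF⟩

/-- RES36 from `Residual37` modulo the named fact `FLS2015_theorem3` and g35's FMD. [cite: FreitasLeHungSiksek2015, Thm. 3] -/
theorem residual36_of_FLS2015_theorem3 (h3 : FLS2015_theorem3) (hF : FifteenModuliDoor) (hR : Residual37) :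
    Residual36 :=
  residual36_of_pieces (cartanFiveDoor_of_FLS2015_theorem3 h3) hF hR

/-- Two storeys: RES35 ⟸ BOX13 ∧ SMD ∧ C5D ∧ FMD ∧ `Residual37` (g35's `residual35_of_pieces` composed with this node). -/
theorem residual35_of_pieces37 (hB : Box2022_theorem1_3) (hS : SevenModuliDoor) (hD : CartanFiveDoor)
    (hF : FifteenModuliDoor) (hR : Residual37) : Residual35 :=
  residual35_of_pieces hB hS (residual36_of_pieces hD hF hR)

/-! ## §5 One storey up: the field-level form on `15`-stable fields containing `√5` -/

/-- **Over a `15`-stable totally real `K₀ ∋ √5`, every NON-modular `E` lives on a Cartan-`5` curve**: it has shape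
`(b3 ∨ s3⁺)` at `3` and `H8 ∨ H12` at `5` — the Borel-`5` shape would give `j ∈ ℚ` (FMD) and then modularity by descent +
base change (DBC = `RatBaseChangeModularity`).  Modulo C5D ∧ FMD ∧ DBC; this is the `√5`-analogue of g35's
`modular_of_stable`, with the four curves `X(u3,H8)`, `X(u3,H12)` as the named remainder. -/
theorem cartan_of_not_modular_of_stable (hD : CartanFiveDoor) (hF : FifteenModuliDoor) (hDBC : RatBaseChangeModularity)
    (K₀ : Type) [Field K₀] [NumberField K₀] (hK : IsTotallyReal K₀) (h5 : IsSquare (5 : K₀)) (hst : FifteenStable K₀)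
    (E : WeierstrassCurve (𝓞 K₀)) (hΔ : E.Δ ≠ 0) (hne : ¬ IsModularEllipticCurve K₀ E) :
    BorelOrSplitCartanThree K₀ E ∧ (H8At K₀ E ∨ H12At K₀ E) := by
  obtain ⟨h3, hb | h8 | h12⟩ := hD K₀ hK h5 E hΔ hne
  · obtain ⟨q, hq⟩ := hF K₀ E hΔ h3 hb hst
    exact absurd (isModularEllipticCurve_of_jInv_eq_ratCast hDBC K₀ E hΔ q hq.symm) hne
  · exact ⟨h3, Or.inl h8⟩
  · exact ⟨h3, Or.inr h12⟩

/-- The same modulo the named fact `FLS2015_theorem3` in place of C5D. [cite: FreitasLeHungSiksek2015, Thm. 3] -/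
theorem cartan_of_not_modular_of_stable_of_FLS2015_theorem3 (h3 : FLS2015_theorem3) (hF : FifteenModuliDoor)
    (hDBC : RatBaseChangeModularity) (K₀ : Type) [Field K₀] [NumberField K₀] (hK : IsTotallyReal K₀)
    (h5 : IsSquare (5 : K₀)) (hst : FifteenStable K₀) (E : WeierstrassCurve (𝓞 K₀)) (hΔ : E.Δ ≠ 0)
    (hne : ¬ IsModularEllipticCurve K₀ E) : BorelOrSplitCartanThree K₀ E ∧ (H8At K₀ E ∨ H12At K₀ E) :=
  cartan_of_not_modular_of_stable (cartanFiveDoor_of_FLS2015_theorem3 h3) hF hDBC K₀ hK h5 hst E hΔ hne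

/-! ## §6 BY NAME up the lineage: the door costs NOTHING new — `FLS2015_theorems3_4` is already a binder of REST -/

/-- RES36 from `Residual37` under the lineage's EXISTING binder `h34 : FLS2015_theorems3_4` (tree:
`FLS2015_theorem3_of_theorems3_4`) and g35's FMD — the `√5`-sector door adds no hypothesis to the cone of
stmt-Langlands-26998. [cite: FreitasLeHungSiksek2015, Thms. 3, 4] -/
theorem residual36_of_theorems3_4 (h34 : FLS2015_theorems3_4) (hF : FifteenModuliDoor) (hR : Residual37) : Residual36 :=
  residual36_of_FLS2015_theorem3 (FLS2015_theorem3_of_theorems3_4 h34) hF hR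

/-- **REST (stmt-Langlands-26998) BY NAME**: g35's `MordellWeilSevenSplit.closes_byName` with `Residual36` replaced by
`Residual37` and NO other change of binders (C5D is discharged by the binder `h34` already present). CONDITIONAL display
via `closure.modulo`; credits nothing. -/
theorem closes_byName (hDBC : RatBaseChangeModularity) (hNSBC : SmallFieldBaseChange)
    (hFLS : FLS2015_theorem1) (hDNS : DNS2020_theorem4) (hBox : Box2022_theorem1_1)
    (hADC : AllenDyadicCorollary) (h34 : FLS2015_theorems3_4) (hSW : SkinnerWilesDihedralDoor)
    (hPZ : PanZhangSupersingularDoor) (hNO3 : NearlyOrdinaryDihedralDoorThree) (hNOS : SplitOrdinaryDihedralDoor)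
    (hMIX : MixedSignatureDoor) (hNOD : NearlyOrdinaryDistinguishedDoor) (hB : Box2022_theorem1_3)
    (hF : FifteenModuliDoor) (hS : SevenModuliDoor) (hR : Residual37)
    (hIMT : IntegralModelTransferPointwise)
    (hTr : Summit.Langlands.Langlands.Theses.EllipticDegreeLadder.EllipticTransportAnyBase)
    (hW : Summit.Langlands.Langlands.Theses.EllipticDegreeLadder.SatakeAvatarExistence)
    (h1 : Summit.Langlands.Langlands.Theses.EllipticDegreeLadder.RankOneAutomorphy) :
    Summit.Langlands.Langlands.Theses.TowerDoorSplit.UnanchoredHighDegreeWitnessAutomorphy :=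
  Summit.Langlands.Langlands.Theorems.MordellWeilSevenSplit.closes_byName hDBC hNSBC hFLS hDNS hBox hADC h34 hSW hPZ
    hNO3 hNOS hMIX hNOD hB hF hS (residual36_of_theorems3_4 h34 hF hR) hIMT hTr hW h1

/-! ## §7 Sanity: the generators are as printed (orders `8` and `12` subgroups of `{det = ±1}`) -/

/-- `diag(2,3)` and `antidiag(1,1)` have determinant `1` resp. `-1`; `(3 1;3 3)` and `diag(1,4)` have determinant `1`
resp. `-1` — all in `{det = ±1} = χ̄₅(Γ_{K₀})` for `K₀ ∋ √5`. -/
theorem generators_det :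
    Matrix.det (!![2, 0; 0, 3] : Matrix (Fin 2) (Fin 2) (ZMod 5)) = 1 ∧
    Matrix.det (!![0, 1; 1, 0] : Matrix (Fin 2) (Fin 2) (ZMod 5)) = -1 ∧
    Matrix.det (!![3, 1; 3, 3] : Matrix (Fin 2) (Fin 2) (ZMod 5)) = 1 ∧
    Matrix.det (!![1, 0; 0, 4] : Matrix (Fin 2) (Fin 2) (ZMod 5)) = -1 := by
  refine ⟨?_, ?_, ?_, ?_⟩ <;> decide

/-- `(3 1;3 3)` has order `3`·`2`-type behaviour: its cube is `-1` (so it generates, with `diag(1,4)`, a dihedral group of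
order `12` containing the non-split Cartan element of order `6`), and `diag(2,3)² = -1` (order `4`, the `D₄ = H8` case). -/
theorem generators_orders :
    (!![3, 1; 3, 3] : Matrix (Fin 2) (Fin 2) (ZMod 5)) ^ 3 = -1 ∧
    (!![2, 0; 0, 3] : Matrix (Fin 2) (Fin 2) (ZMod 5)) ^ 2 = -1 := by
  constructor <;> decide

end Summit.Langlands.Langlands.Theorems.CartanFiveSplit
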